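import Mathlib
import Summits.NavierStokesRegularity.NavierStokesRegularity.Theorems.TaoLadderRungTwoFlatHopTubeWeightTwoPiece
import HarnessLib

/-!
# THE FOUR ENVELOPE ROWS OF `tubeStepEnvelopeWith_of_schedule_slot` FOR THE PIECEWISE TUBE ENVELOPE (`tubeEnv` / `tubeEnv₂`):
  behind / interface / window / ahead rows from three scalar `Eb`-rows, the window hull rows on `[k₁, k_H+1]`, the cut-size row `hGr`,
  `θ′ ≤ 2θ_b·log(1+ε₀)` and `K₀ ≥ 1/128` (referee W-31 / A-126: the `env₀`-vs-`tubeEnv` identification, typed)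
  (helper for the K_A♭ parent item stmt-NavierStokesRegularity-22987 `FlatGapCertificatesV2`, child 2A `GradedAdiabaticWakeA` of route
  TaoLadderRungTwoFlat; cell harvest/h2-tao-ladder, p1 g25; LADDER §50.8–50.9 (`tubeEnv`), §54, §62)

The envelope obligation assembled in `…EnvelopeSplit` takes four rows against an arbitrary `env₀`:
`henvB : e^{θ′(1−K−k)}·B ≤ env₀ k` (`k ≤ −K`), `henvI : E_I ≤ env₀ (1−K)`, `henvW : ½H_k² ≤ env₀ k` (`2−K ≤ k ≤ k_H+1`),
`henvA : 2G(m−1)² ≤ env₀ m` (`m > k_H+1`). The statics (`TubeStaticsWith`, clause `TailCompat`) pin `env₀` AHEAD of `k₁` to the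
shifted tolerance scale `K₀r²/w(k−1)²`; the tube envelope of record is PIECEWISE — that scale from `k₁` on, the growing scale
`Eb·(1+ε₀)^{2θ_b|k|}` below (`tubeEnv`, `tubeEnv₂`). For such an envelope the four rows reduce to: (behind) ONE scalar row
`e^{θ′(1−K)}·B ≤ Eb` when `θ′ ≤ 2θ_b·log(1+ε₀)` (the slow exponent of the R54 statics: `e^{−θ′k} ≤ (1+ε₀)^{2θ_b|k|}` for `k ≤ 0`);
(interface) `E_I ≤ Eb`; (window) `½H_k² ≤ Eb` below `k₁` and the genuine rows `½H_k² ≤ K₀r²/w(k−1)²` on `[k₁, k_H+1]`; (ahead) NOTHING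
new — the cut-size row `8·w_k·(2G_k) ≤ r·AFL` of the ahead zone (`hGr`, `AFL ≤ 1`) already gives `2G_k² ≤ r²/(128 w_k²) ≤ K₀r²/w_k²` once
`K₀ ≥ 1/128`.

* `two_mul_sq_le_of_cut_row` — `8·w·(2G) ≤ r·AFL`, `AFL ≤ 1`, `K₀ ≥ 1/128` ⇒ `2G² ≤ K₀r²/w²`;
* `exp_behind_le_rpow` — `e^{θ′·(−k)} ≤ (1+ε₀)^{2θ_b·(−k)}` for `k ≤ 0`, `θ′ ≤ 2θ_b log(1+ε₀)`;
* `envelopeRows_of_piecewise` — the four rows for any envelope equal to `K₀r²/w(k−1)²` on `k ≥ k₁` and to `Eb(1+ε₀)^{2θ_b|k|}` below;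
* `envelopeRows_tubeEnv`, `envelopeRows_tubeEnv₂` — the instances for `tubeEnv P ε₀ K₀ r C b Eb` / `tubeWeight C b` and
  `tubeEnv₂ P ε₀ K₀ r C b kA Eb` / `tubeWeight₂ C b kA`.

HONEST FRAMING: elementary real-number bookkeeping over the cell's typed induction frame (MODEL lattice); nothing certified; no item
closed; nothing about the Navier–Stokes equations.
-/

noncomputable section

-- the sub-problem namespace repeats the summit name by design (D-0017)
set_option linter.dupNamespace false

namespace Summit.NavierStokesRegularity.NavierStokesRegularity.Theorems.HopTube

open Set Finset Literature.Analysis.FluidPDE Literature.Analysis.FluidPDE.TaoCascade MirrorPulse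

/-- **The ahead row is free**: the cut-size row `8·w·(2G) ≤ r·AFL` (`AFL ≤ 1`, `0 ≤ r`, `0 < w`, `0 ≤ G`) and `K₀ ≥ 1/128` give
`2G² ≤ K₀r²/w²`. [folklore (elementary); cell LADDER §62 (cut schedule), §50.9 (`tubeEnv`)] -/
theorem two_mul_sq_le_of_cut_row {wk Gk r AFL K₀ : ℝ} (hw : 0 < wk) (hG : 0 ≤ Gk) (hr : 0 ≤ r) (hAFL1 : AFL ≤ 1)
    (hK₀ : 1 / 128 ≤ K₀) (hGr : 8 * (wk * (2 * Gk)) ≤ r * AFL) : 2 * Gk ^ 2 ≤ K₀ * r ^ 2 / wk ^ 2 := by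
  have h16 : wk * Gk ≤ r / 16 := by
    have : r * AFL ≤ r * 1 := mul_le_mul_of_nonneg_left hAFL1 hr
    linarith
  have hwG0 : 0 ≤ wk * Gk := mul_nonneg hw.le hG
  have hsq : (wk * Gk) ^ 2 ≤ (r / 16) ^ 2 := pow_le_pow_left₀ hwG0 h16 2
  rw [le_div_iff₀ (pow_pos hw 2)]
  have hr2 : 0 ≤ r ^ 2 := sq_nonneg r
  nlinarith

/-- **The slow behind exponent is dominated by the growing envelope scale**: `e^{θ′·(−k)} ≤ (1+ε₀)^{2θ_b·(−k)}` for `k ≤ 0` when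
`θ′ ≤ 2θ_b·log(1+ε₀)` (`0 ≤ ε₀`). [folklore (monotonicity of `exp`); cell LADDER §54 (R54-1 slow exponent), §50.9] -/
theorem exp_behind_le_rpow {ε₀ θ' θb : ℝ} (hε₀ : 0 ≤ ε₀) (hθ2 : θ' ≤ 2 * θb * Real.log (1 + ε₀)) {x : ℝ} (hx : 0 ≤ x) :
    Real.exp (θ' * x) ≤ (1 + ε₀) ^ (2 * θb * x) := by
  have h1ε : 0 < 1 + ε₀ := by linarith
  rw [Real.rpow_def_of_pos h1ε]
  apply Real.exp_le_exp.mpr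
  calc θ' * x ≤ (2 * θb * Real.log (1 + ε₀)) * x := mul_le_mul_of_nonneg_right hθ2 hx
    _ = Real.log (1 + ε₀) * (2 * θb * x) := by ring

/-- **THE FOUR ENVELOPE ROWS FOR A PIECEWISE ENVELOPE.** For `env₀ k = K₀r²/w(k−1)²` on `k ≥ k₁` and `env₀ k = Eb·(1+ε₀)^{2θ_b|k|}` on
`k < k₁` (`1 ≤ k₁ ≤ k_H + 2`, `1 ≤ K`, `0 ≤ θ_b`): the behind rows from `e^{θ′(1−K)}·B ≤ Eb` (slow exponent), the interface row from
`E_I ≤ Eb`, the window rows from `½H_k² ≤ Eb` (below `k₁`) and `½H_k² ≤ K₀r²/w(k−1)²` (on `[k₁, k_H+1]`), the ahead rows from the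
cut-size row `hGr` (`K₀ ≥ 1/128`). Output = the literal `henvB`, `henvI`, `henvW`, `henvA` of `tubeStepEnvelopeWith_of_schedule_slot`.
[cite: Tao2016AveragedNS, §6.2 Prop. 6.3 (ix) (energy envelope, statement shape); cell LADDER §50.8–50.9 (`tubeEnv`), §54, §62; referee W-31 / A-126] -/
theorem envelopeRows_of_piecewise (P : TubeSchedule) {ε₀ θ' K₀ Eb r AFL B EI : ℝ} {w env₀ Hk G : ℤ → ℝ} {kH : ℤ}
    (hhi : ∀ k : ℤ, (P.k₁ : ℤ) ≤ k → env₀ k = K₀ * r ^ 2 / w (k - 1) ^ 2)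
    (hlo : ∀ k : ℤ, k < (P.k₁ : ℤ) → env₀ k = Eb * (1 + ε₀) ^ (2 * P.θb * |(k : ℝ)|))
    (hε₀ : 0 ≤ ε₀) (hθb : 0 ≤ P.θb) (hK : 1 ≤ P.K) (hk₁ : 1 ≤ P.k₁) (hk₁H : (P.k₁ : ℤ) ≤ kH + 2)
    (hθ2 : θ' ≤ 2 * P.θb * Real.log (1 + ε₀)) (hEb0 : 0 ≤ Eb)
    (hEbB : Real.exp (θ' * ((1 : ℝ) - P.K)) * B ≤ Eb) (hEbI : EI ≤ Eb)
    (hEbW : ∀ k : ℤ, 2 - (P.K : ℤ) ≤ k → k < (P.k₁ : ℤ) → (1 / 2) * Hk k ^ 2 ≤ Eb)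
    (hHk : ∀ k : ℤ, (P.k₁ : ℤ) ≤ k → k ≤ kH + 1 → (1 / 2) * Hk k ^ 2 ≤ K₀ * r ^ 2 / w (k - 1) ^ 2)
    (hK₀ : 1 / 128 ≤ K₀) (hr : 0 ≤ r) (hw : ∀ k, 0 < w k) (hAFL1 : AFL ≤ 1)
    (hG0 : ∀ j, kH < j → 0 ≤ G j) (hGr : ∀ k, kH < k → 8 * (w k * (2 * G k)) ≤ r * AFL) :
    (∀ k : ℤ, k ≤ -(P.K : ℤ) → Real.exp (θ' * ((1 : ℝ) - P.K - k)) * B ≤ env₀ k) ∧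
      EI ≤ env₀ (1 - (P.K : ℤ)) ∧
      (∀ k : ℤ, 2 - (P.K : ℤ) ≤ k → k ≤ kH + 1 → (1 / 2) * Hk k ^ 2 ≤ env₀ k) ∧
      (∀ m : ℤ, kH + 1 < m → 2 * G (m - 1) ^ 2 ≤ env₀ m) := by
  have h1ε : 1 ≤ 1 + ε₀ := by linarith
  -- the growing scale is at least `Eb` everywhere
  have hpow1 : ∀ k : ℤ, 1 ≤ (1 + ε₀) ^ (2 * P.θb * |(k : ℝ)|) := fun k =>
    Real.one_le_rpow h1ε (mul_nonneg (mul_nonneg (by norm_num) hθb) (abs_nonneg _))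
  have hloEb : ∀ k : ℤ, k < (P.k₁ : ℤ) → Eb ≤ env₀ k := fun k hk => by
    rw [hlo k hk]; exact le_mul_of_one_le_right hEb0 (hpow1 k)
  refine ⟨fun k hk => ?_, ?_, fun k hk2 hkH => ?_, fun m hm => ?_⟩
  · -- behind: slow exponent against the growing scale
    have hk0 : k ≤ 0 := by omega
    have hk1 : k < (P.k₁ : ℤ) := by omega
    rw [hlo k hk1]
    have hkR : ((k : ℤ) : ℝ) ≤ 0 := by exact_mod_cast hk0
    rw [abs_of_nonpos hkR]
    have hpow := exp_behind_le_rpow (θb := P.θb) hε₀ hθ2 (neg_nonneg.mpr hkR)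
    have e : Real.exp (θ' * ((1 : ℝ) - P.K - k)) = Real.exp (θ' * (1 - P.K)) * Real.exp (θ' * (-(k : ℝ))) := by
      rw [← Real.exp_add]; ring_nf
    calc Real.exp (θ' * ((1 : ℝ) - P.K - k)) * B = (Real.exp (θ' * (1 - P.K)) * B) * Real.exp (θ' * (-(k : ℝ))) := by
          rw [e]; ring
      _ ≤ Eb * (1 + ε₀) ^ (2 * P.θb * (-(k : ℝ))) := mul_le_mul hEbB hpow (Real.exp_pos _).le hEb0
  · -- interface shell `1 − K < k₁`
    exact hEbI.trans (hloEb _ (by omega))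
  · -- window
    rcases lt_or_ge k (P.k₁ : ℤ) with hk | hk
    · exact (hEbW k hk2 hk).trans (hloEb k hk)
    · rw [hhi k hk]; exact hHk k hk hkH
  · -- ahead: free from the cut-size row
    rw [hhi m (by omega)]
    exact two_mul_sq_le_of_cut_row (hw _) (hG0 _ (by omega)) hr hAFL1 hK₀ (hGr (m - 1) (by omega))

/-- **The rows for `tubeEnv` / `tubeWeight`** (`C ≥ 1`, `b ≥ 0`). [cite: Tao2016AveragedNS, §6.2 Prop. 6.3 (ix) (statement shape); cell LADDER §50.9 (`tubeEnv`); referee W-31 / A-126] -/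
theorem envelopeRows_tubeEnv (P : TubeSchedule) {ε₀ θ' K₀ Eb r C b AFL B EI : ℝ} {Hk G : ℤ → ℝ} {kH : ℤ}
    (hC : 1 ≤ C) (hb : 0 ≤ b)
    (hε₀ : 0 ≤ ε₀) (hθb : 0 ≤ P.θb) (hK : 1 ≤ P.K) (hk₁ : 1 ≤ P.k₁) (hk₁H : (P.k₁ : ℤ) ≤ kH + 2)
    (hθ2 : θ' ≤ 2 * P.θb * Real.log (1 + ε₀)) (hEb0 : 0 ≤ Eb)
    (hEbB : Real.exp (θ' * ((1 : ℝ) - P.K)) * B ≤ Eb) (hEbI : EI ≤ Eb)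
    (hEbW : ∀ k : ℤ, 2 - (P.K : ℤ) ≤ k → k < (P.k₁ : ℤ) → (1 / 2) * Hk k ^ 2 ≤ Eb)
    (hHk : ∀ k : ℤ, (P.k₁ : ℤ) ≤ k → k ≤ kH + 1 → (1 / 2) * Hk k ^ 2 ≤ K₀ * r ^ 2 / tubeWeight C b (k - 1) ^ 2)
    (hK₀ : 1 / 128 ≤ K₀) (hr : 0 ≤ r) (hAFL1 : AFL ≤ 1)
    (hG0 : ∀ j, kH < j → 0 ≤ G j) (hGr : ∀ k, kH < k → 8 * (tubeWeight C b k * (2 * G k)) ≤ r * AFL) :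
    (∀ k : ℤ, k ≤ -(P.K : ℤ) → Real.exp (θ' * ((1 : ℝ) - P.K - k)) * B ≤ tubeEnv P ε₀ K₀ r C b Eb k) ∧
      EI ≤ tubeEnv P ε₀ K₀ r C b Eb (1 - (P.K : ℤ)) ∧
      (∀ k : ℤ, 2 - (P.K : ℤ) ≤ k → k ≤ kH + 1 → (1 / 2) * Hk k ^ 2 ≤ tubeEnv P ε₀ K₀ r C b Eb k) ∧
      (∀ m : ℤ, kH + 1 < m → 2 * G (m - 1) ^ 2 ≤ tubeEnv P ε₀ K₀ r C b Eb m) :=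
  envelopeRows_of_piecewise P (fun _ hk => tubeEnv_of_le P ε₀ K₀ r C b Eb hk) (fun _ hk => tubeEnv_of_lt P ε₀ K₀ r C b Eb hk)
    hε₀ hθb hK hk₁ hk₁H hθ2 hEb0 hEbB hEbI hEbW hHk hK₀ hr (fun k => lt_of_lt_of_le one_pos (one_le_tubeWeight hC hb k))
    hAFL1 hG0 hGr

/-- **The rows for `tubeEnv₂` / `tubeWeight₂`** (two-piece weight, `C ≥ 1`, `b ≥ 0`). [cite: Tao2016AveragedNS, §6.2 Prop. 6.3 (ix) (statement shape); cell LADDER §50.9, §52.5 (R52-2); referee W-31 / A-126] -/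
theorem envelopeRows_tubeEnv₂ (P : TubeSchedule) {ε₀ θ' K₀ Eb r C b AFL B EI : ℝ} {kA : ℕ} {Hk G : ℤ → ℝ} {kH : ℤ}
    (hC : 1 ≤ C) (hb : 0 ≤ b)
    (hε₀ : 0 ≤ ε₀) (hθb : 0 ≤ P.θb) (hK : 1 ≤ P.K) (hk₁ : 1 ≤ P.k₁) (hk₁H : (P.k₁ : ℤ) ≤ kH + 2)
    (hθ2 : θ' ≤ 2 * P.θb * Real.log (1 + ε₀)) (hEb0 : 0 ≤ Eb)
    (hEbB : Real.exp (θ' * ((1 : ℝ) - P.K)) * B ≤ Eb) (hEbI : EI ≤ Eb)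
    (hEbW : ∀ k : ℤ, 2 - (P.K : ℤ) ≤ k → k < (P.k₁ : ℤ) → (1 / 2) * Hk k ^ 2 ≤ Eb)
    (hHk : ∀ k : ℤ, (P.k₁ : ℤ) ≤ k → k ≤ kH + 1 → (1 / 2) * Hk k ^ 2 ≤ K₀ * r ^ 2 / tubeWeight₂ C b kA (k - 1) ^ 2)
    (hK₀ : 1 / 128 ≤ K₀) (hr : 0 ≤ r) (hAFL1 : AFL ≤ 1)
    (hG0 : ∀ j, kH < j → 0 ≤ G j) (hGr : ∀ k, kH < k → 8 * (tubeWeight₂ C b kA k * (2 * G k)) ≤ r * AFL) :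
    (∀ k : ℤ, k ≤ -(P.K : ℤ) → Real.exp (θ' * ((1 : ℝ) - P.K - k)) * B ≤ tubeEnv₂ P ε₀ K₀ r C b kA Eb k) ∧
      EI ≤ tubeEnv₂ P ε₀ K₀ r C b kA Eb (1 - (P.K : ℤ)) ∧
      (∀ k : ℤ, 2 - (P.K : ℤ) ≤ k → k ≤ kH + 1 → (1 / 2) * Hk k ^ 2 ≤ tubeEnv₂ P ε₀ K₀ r C b kA Eb k) ∧
      (∀ m : ℤ, kH + 1 < m → 2 * G (m - 1) ^ 2 ≤ tubeEnv₂ P ε₀ K₀ r C b kA Eb m) :=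
  envelopeRows_of_piecewise P (fun _ hk => tubeEnv₂_of_le P ε₀ K₀ r C b kA Eb hk)
    (fun k hk => by simp [tubeEnv₂, not_le.mpr hk])
    hε₀ hθb hK hk₁ hk₁H hθ2 hEb0 hEbB hEbI hEbW hHk hK₀ hr (fun k => lt_of_lt_of_le one_pos (one_le_tubeWeight₂ hC hb kA k))
    hAFL1 hG0 hGr

end Summit.NavierStokesRegularity.NavierStokesRegularity.Theorems.HopTube

end
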